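import Literature.NumberTheory.EllipticCurves.StrictSelmerRankOne
import Literature.NumberTheory.GaloisRepresentations.PadicAlgebraDegreeOnePlace
import HarnessLib

/-!
# Rank one and finite `Ш[p^∞]` force the `w`-strict Selmer group to be finite at a place
# `w ∣ p` of degree one of a number field

Trunk T-NT-EC (`Literature/NumberTheory/EllipticCurves`), companion to `StrictSelmerRankOne`
(which treats `E/ℚ` and the place `ℚ_p`). PROOFS ONLY: no named fact and no definition is
introduced.

For an elliptic curve `E` over a number field `K` (any model `W`), a prime `p` and a finite place
`w ∣ p` of `K` OF DEGREE ONE (`e(w|p) = f(w|p) = 1`, so that `K_w ≅ ℚ_p`): if `rank_ℤ E(K) = 1`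
and `Ш(E/K)[p^∞]` is finite, then the `w`-strict Selmer group
`Sel_{p^∞}(E/K) ∩ ker (H¹(K, E[p^∞]) → H¹(K_w, E[p^∞]))` — in the tree
`W.selmerGroupPInfty p ⊓ selmerLocalKerPrimaryTorsion W (w.adicCompletion K) p` — is finite
(`finite_strictSelmer_adicCompletion_of_mordellWeilRank_eq_one`); hence so is the joint strict
Selmer group at all the places above `p` as soon as ONE of them has degree one
(`finite_strictSelmer_iInf_adicCompletion_of_mordellWeilRank_eq_one`), and in a quadratic field
in which `p` splits the conclusion holds at EVERY `w ∣ p`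
(`finite_strictSelmer_adicCompletion_of_mordellWeilRank_eq_one_of_ncard_primesOver_eq_two`,
`finite_strictSelmer_iInf_adicCompletion_of_mordellWeilRank_eq_one_of_ncard_primesOver_eq_two`).

## Sources

* C. Skinner, Ann. of Math. 191 (2020), §2.2, Lemma 2 of the arXiv text (arXiv:1405.7294, p. 8,
  «Lemma rank1lemma»): "If `rank_ℤ A_f(K) = [M_f:ℚ]` and `#Ш(A_f/K)[p^∞] < ∞`, then
  `dim_L H¹_f(K,V) = 1` and the restriction map `H¹_f(K,V) → H¹(K_𝔩,V)` is an injection for each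
  `𝔩 ∣ p`." Printed for EVERY `𝔩 ∣ p` over any number field `K`; the present file proves the
  `p^∞`-Selmer form (finiteness of the `𝔩`-strict Selmer group, as in `StrictSelmerRankOne`) at
  the places `𝔩` OF DEGREE ONE only — WEAKER than print: the tree's device
  `finite_strictSelmer_of_mordellWeilRank_eq_one_of_hom` consumes a homomorphism
  `E(K_𝔩) → ℤ_p` whose kernel is the torsion, available when `K_𝔩 ≅ ℚ_p`.
  -- TODO(general form): every `𝔩 ∣ p` (replace `λ` by `E(K_𝔩) → ℤ_p^{[K_𝔩:ℚ_p]}`, AEC VII.6.3).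
* A. Burungale, C. Skinner, Y. Tian, X. Wan, arXiv:2409.01350v2 (PREPRINT), §12.1.2, proof of
  Thm. 12.3 (p. 96): "it follows that `corank_{𝒪_λ} Sel_{λ^∞}(A_{g/L}) = 1` and `Ш(A_{g/L})[λ^∞]`
  is finite. In particular, the hypothesis (inj) holds" — `L` imaginary quadratic with `p` split;
  (inj) is the hypothesis of Prop. 12.1, carried in the tree by the binder
  `Finite ↥(Sel_{p^∞}(E/K) ⊓ ⨅_{w ∣ p} ker loc_w)` of
  `BurungaleSkinnerTianWan2024.prop121_pConverse_of_charIdealLe_ordinary_OPEN` (and by the `hres`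
  binder of the Summit-side `finite_selmerAcBase_of_resCorankOne_imaginaryQuadratic`). The last two
  theorems of this file are that step in the RANK currency (`rank_ℤ E(K) = 1`); the passage from
  `corank = 1 ∧ #Ш[p^∞] < ∞` to `rank = 1` is `SelmerCorankProofs`' business, not repeated here.
* `K_w ≅ ℚ_p` at a place of degree one: Cassels–Fröhlich, Ch. I (Fröhlich), §10, proof of Prop. 1,
  «`(L_𝔓 : K_𝔭) = e_𝔓 f_𝔓`» (tree: `LocalField.bijective_algebraMap_adicCompletionPadicAlgebra`,
  from `Automorphic.surjective_adicCompletionOfLiesOver`).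

## The argument

Along ANY ring homomorphism `φ : F → ℚ_p` from a `K`-field `F`, Mathlib's
`WeierstrassCurve.Affine.Point.map` embeds `E(F) ↪ E(ℚ_p)` as a group (`Point.map_injective`), and
an injective homomorphism preserves and reflects finite order
(`Function.Injective.isOfFinAddOrder_iff`); so `λ ∘ map φ`, with `λ : E(ℚ_p) → ℤ_p` the
homomorphism of `exists_addMonoidHom_padicInt_apply_eq_zero_iff` (Silverman AEC VII.6.3: a
finite-index subgroup `≅ ℤ_p`), vanishes exactly on the torsion of `E(F)`
(`exists_addMonoidHom_padicInt_apply_eq_zero_iff_of_ringHom`). At a degree-one place `w ∣ p` the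
canonical `ℚ_p → K_w` is bijective, whence `φ : K_w ≅ ℚ_p`; feed `λ ∘ map φ` to
`finite_strictSelmer_of_mordellWeilRank_eq_one_of_hom`. The joint version is a subgroup of the
`w₀`-strict one; in a quadratic field with two primes above `p` every `w ∣ p` has `e = f = 1`
(`LocalField.ramificationIdx_eq_one_and_inertiaDeg_eq_one_of_ne`).
-/

noncomputable section

open scoped Classical

open IsDedekindDomain NumberField WeierstrassCurve

universe u v

namespace Literature.NumberTheory.EllipticCurves

/-! ### 1. Transport of `λ : E(ℚ_p) → ℤ_p` along a field embedding into `ℚ_p` -/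

/-- **`λ : E(F) → ℤ_p` with kernel the torsion, for any `K`-field `F` embedding in `ℚ_p`.** For an
elliptic curve `W/K`, a prime `p` and a ring homomorphism `φ : F →+* ℚ_p` from a `K`-field `F`:
there is an additive `λ : E(F) → ℤ_p` with `λ X = 0 ↔ X` of finite order — namely
`λ₀ ∘ E(φ)` with `λ₀ : E(ℚ_p) → ℤ_p` from Silverman AEC VII.6.3
(`exists_addMonoidHom_padicInt_apply_eq_zero_iff`) and `E(φ) : E(F) ↪ E(ℚ_p)` Mathlib's injective
`Affine.Point.map`. [cite: SilvermanAEC2009, Prop. VII.6.3] -/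
theorem exists_addMonoidHom_padicInt_apply_eq_zero_iff_of_ringHom {K : Type u} [Field K]
    (W : WeierstrassCurve K) [W.IsElliptic] (p : ℕ) [Fact p.Prime] {F : Type v} [Field F]
    [Algebra K F] (φ : F →+* ℚ_[p]) :
    ∃ lam : (W.baseChange F).toAffine.Point →+ ℤ_[p], ∀ X, lam X = 0 ↔ IsOfFinAddOrder X := by
  letI : Algebra K ℚ_[p] := (φ.comp (algebraMap K F)).toAlgebra
  let f : F →ₐ[K] ℚ_[p] := ⟨φ, fun _ => rfl⟩
  haveI : (W.baseChange ℚ_[p]).IsElliptic := by rw [baseChange]; infer_instance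
  obtain ⟨lam₀, hlam₀⟩ := exists_addMonoidHom_padicInt_apply_eq_zero_iff p (W.baseChange ℚ_[p])
  refine ⟨lam₀.comp (Affine.Point.map (W' := W) f), fun X => ?_⟩
  rw [AddMonoidHom.comp_apply, hlam₀]
  exact (Affine.Point.map_injective (W' := W) f).isOfFinAddOrder_iff

/-! ### 2. The place `w ∣ p` of degree one: `K_w ≅ ℚ_p` -/

section DegreeOne

variable {K : Type} [Field K] [NumberField K] (W : WeierstrassCurve K) [W.IsElliptic]
  (p : ℕ) [Fact p.Prime] (w : HeightOneSpectrum (𝓞 K))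

/-- **`K_w ≅ ℚ_p` at a place of degree one.** If `p ∈ w` and `e(w|p) = f(w|p) = 1` (over `𝓞 ℚ`),
the completion `K_w` is ring-isomorphic to `ℚ_p`: the canonical `ℚ_p`-algebra map `ℚ_p → K_w`
(`LocalField.adicCompletionPadicAlgebra`) is bijective
(`LocalField.bijective_algebraMap_adicCompletionPadicAlgebra`) — the case `[K_w : ℚ_p] = e f = 1`
of the local degree formula. [cite: CasselsFrohlich1967, Ch. I §10, proof of Prop. 1 ((L_𝔓 : K_𝔭) = e_𝔓 f_𝔓)] -/
theorem nonempty_ringEquiv_adicCompletion_padic_of_degree_one (hw : ((p : ℕ) : 𝓞 K) ∈ w.asIdeal)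
    (he : w.asIdeal.ramificationIdx (𝓞 ℚ) = 1) (hf : w.asIdeal.inertiaDeg (𝓞 ℚ) = 1) :
    Nonempty (w.adicCompletion K ≃+* ℚ_[p]) := by
  letI := GaloisRepresentations.LocalField.adicCompletionPadicAlgebra w p hw
  have hb := GaloisRepresentations.LocalField.bijective_algebraMap_adicCompletionPadicAlgebra
    p w hw he hf
  exact ⟨(RingEquiv.ofBijective (algebraMap ℚ_[p] (w.adicCompletion K)) hb).symm⟩

/-- **`λ : E(K_w) → ℤ_p` with kernel the torsion, at a place `w ∣ p` of degree one** (`K_w ≅ ℚ_p`;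
Silverman AEC VII.6.3 transported along the isomorphism). [cite: SilvermanAEC2009, Prop. VII.6.3] -/
theorem exists_addMonoidHom_padicInt_apply_eq_zero_iff_adicCompletion
    (hw : ((p : ℕ) : 𝓞 K) ∈ w.asIdeal) (he : w.asIdeal.ramificationIdx (𝓞 ℚ) = 1)
    (hf : w.asIdeal.inertiaDeg (𝓞 ℚ) = 1) :
    ∃ lam : (W.baseChange (w.adicCompletion K)).toAffine.Point →+ ℤ_[p],
      ∀ X, lam X = 0 ↔ IsOfFinAddOrder X := by
  obtain ⟨φ⟩ := nonempty_ringEquiv_adicCompletion_padic_of_degree_one p w hw he hf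
  exact exists_addMonoidHom_padicInt_apply_eq_zero_iff_of_ringHom W p φ.toRingHom

/-! ### 3. Finiteness of the `w`-strict Selmer group -/

/-- **Rank one and finite `Ш(E/K)[p^∞]` force the `w`-strict Selmer group to be finite at a place
`w ∣ p` of degree one.** For an elliptic curve `W` over a number field `K`, a prime `p` and a
finite place `w ∋ p` with `e(w|p) = f(w|p) = 1`: if `rank_ℤ E(K) = 1` and `Ш(E/K)[p^∞]` is finite
then `Sel_{p^∞}(E/K) ∩ ker (H¹(K, E[p^∞]) → H¹(K_w, E[p^∞]))` is finite — Skinner's Lemma (§2.2,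
arXiv Lemma 2): "the restriction map `H¹_f(K,V) → H¹(K_𝔩,V)` is an injection for each `𝔩 ∣ p`",
in the `p^∞`-Selmer form of `StrictSelmerRankOne`, at the degree-one `𝔩` (WEAKER than print,
which has every `𝔩 ∣ p`). [cite: Skinner2020, §2.2, Lemma 2 of arXiv:1405.7294 (p. 8, Lemma rank1lemma), case K_𝔩 ≅ ℚ_p] -/
theorem finite_strictSelmer_adicCompletion_of_mordellWeilRank_eq_one
    (hw : ((p : ℕ) : 𝓞 K) ∈ w.asIdeal) (he : w.asIdeal.ramificationIdx (𝓞 ℚ) = 1)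
    (hf : w.asIdeal.inertiaDeg (𝓞 ℚ) = 1) (hrank : W.mordellWeilRank = 1)
    [Finite (AddCommGroup.primaryComponent W.sha p)] :
    Finite ↥(W.selmerGroupPInfty p ⊓ selmerLocalKerPrimaryTorsion W (w.adicCompletion K) p) := by
  haveI := GaloisRepresentations.LocalField.charZero_adicCompletion w
  obtain ⟨lam, hlam⟩ :=
    exists_addMonoidHom_padicInt_apply_eq_zero_iff_adicCompletion W p w hw he hf
  exact finite_strictSelmer_of_mordellWeilRank_eq_one_of_hom W p (w.adicCompletion K) lam hlam hrank

/-- **The joint strict Selmer group at the places above `p` is finite** as soon as ONE place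
`w₀ ∣ p` has degree one (rank one, `Ш(E/K)[p^∞]` finite): it is a subgroup of the `w₀`-strict one.
This is the shape `Finite ↥(Sel_{p^∞}(E/K) ⊓ ⨅_{w ∣ p} ker loc_w)` of hypothesis (inj) of
Burungale–Skinner–Tian–Wan Prop. 12.1 in the tree. [cite: Skinner2020, §2.2, Lemma 2 of arXiv:1405.7294 (p. 8), case K_𝔩 ≅ ℚ_p]
[cite: BurungaleSkinnerTianWan2024, §12.1.1 Prop. 12.1, hypothesis (inj) (p. 95)] -/
theorem finite_strictSelmer_iInf_adicCompletion_of_mordellWeilRank_eq_one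
    (hw : ((p : ℕ) : 𝓞 K) ∈ w.asIdeal) (he : w.asIdeal.ramificationIdx (𝓞 ℚ) = 1)
    (hf : w.asIdeal.inertiaDeg (𝓞 ℚ) = 1) (hrank : W.mordellWeilRank = 1)
    [Finite (AddCommGroup.primaryComponent W.sha p)] :
    Finite ↥(W.selmerGroupPInfty p ⊓ ⨅ (w' : HeightOneSpectrum (𝓞 K))
      (_ : ((p : ℕ) : 𝓞 K) ∈ w'.asIdeal), selmerLocalKerPrimaryTorsion W (w'.adicCompletion K) p) := by
  haveI := finite_strictSelmer_adicCompletion_of_mordellWeilRank_eq_one W p w hw he hf hrank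
  exact Finite.of_injective
    (AddSubgroup.inclusion (inf_le_inf_left _ (iInf₂_le w hw)))
    (AddSubgroup.inclusion_injective _)

end DegreeOne

/-! ### 4. Quadratic fields in which `p` splits -/

section Quadratic

variable {K : Type} [Field K] [NumberField K] (W : WeierstrassCurve K) [W.IsElliptic]
  (p : ℕ) [Fact p.Prime]

/-- A prime of `𝓞 K` over `(p)` contains `p` and is non-zero. [folklore] -/
private theorem natCast_mem_and_ne_bot_of_mem_primesOver {Q : Ideal (𝓞 K)}
    (hQ : Q ∈ (Ideal.span {(p : ℤ)}).primesOver (𝓞 K)) : ((p : ℕ) : 𝓞 K) ∈ Q ∧ Q ≠ ⊥ := by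
  have h : ((p : ℕ) : ℤ) ∈ Q.under ℤ := hQ.2.over ▸ Ideal.mem_span_singleton_self _
  rw [Ideal.under_def, Ideal.mem_comap, map_natCast] at h
  refine ⟨h, fun hQbot => ?_⟩
  rw [hQbot, Ideal.mem_bot, Nat.cast_eq_zero] at h
  exact (Fact.out : p.Prime).ne_zero h

/-- **In a quadratic field with two primes above `p`, every place `w ∋ p` has degree one**
(`e(w|p) = f(w|p) = 1`; fundamental identity `∑ e f = 2`, tree
`LocalField.ramificationIdx_eq_one_and_inertiaDeg_eq_one_of_ne`). [cite: CasselsFrohlich1967, Ch. I §10, Prop. 1 ((L:K) = Σ e_𝔓 f_𝔓)] -/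
theorem ramificationIdx_eq_one_and_inertiaDeg_eq_one_of_ncard_primesOver_eq_two
    (h2 : Module.finrank ℚ K = 2) (hsplit : ((Ideal.span {(p : ℤ)}).primesOver (𝓞 K)).ncard = 2)
    (w : HeightOneSpectrum (𝓞 K)) (hw : ((p : ℕ) : 𝓞 K) ∈ w.asIdeal) :
    w.asIdeal.ramificationIdx (𝓞 ℚ) = 1 ∧ w.asIdeal.inertiaDeg (𝓞 ℚ) = 1 := by
  haveI : Algebra.IsQuadraticExtension ℚ K := ⟨h2⟩
  obtain ⟨P, P', hne, hPP'⟩ := Set.ncard_eq_two.mp hsplit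
  have hP : P ∈ (Ideal.span {(p : ℤ)}).primesOver (𝓞 K) := hPP' ▸ Set.mem_insert P {P'}
  have hP' : P' ∈ (Ideal.span {(p : ℤ)}).primesOver (𝓞 K) :=
    hPP' ▸ Set.mem_insert_of_mem P (Set.mem_singleton P')
  obtain ⟨hpP, hPbot⟩ := natCast_mem_and_ne_bot_of_mem_primesOver p hP
  obtain ⟨hpP', hP'bot⟩ := natCast_mem_and_ne_bot_of_mem_primesOver p hP'
  set v : HeightOneSpectrum (𝓞 K) := ⟨P, hP.1, hPbot⟩ with hv
  set v' : HeightOneSpectrum (𝓞 K) := ⟨P', hP'.1, hP'bot⟩ with hv'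
  have hvv' : v ≠ v' := fun h => hne (congrArg HeightOneSpectrum.asIdeal h)
  obtain ⟨hdeg, hall⟩ :=
    GaloisRepresentations.LocalField.ramificationIdx_eq_one_and_inertiaDeg_eq_one_of_ne p v v'
      hvv' hpP hpP'
  rcases hall w hw with h | h
  · rw [h]; exact hdeg
  · rw [h]
    exact (GaloisRepresentations.LocalField.ramificationIdx_eq_one_and_inertiaDeg_eq_one_of_ne p
      v' v hvv'.symm hpP' hpP).1

/-- **`p` split in a quadratic `K`, rank one, `Ш(E/K)[p^∞]` finite ⟹ the `w`-strict Selmer group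
is finite at EVERY `w ∣ p`** — the step "`corank … = 1` and `Ш(A_{g/L})[λ^∞]` is finite. In
particular, the hypothesis (inj) holds" of the proof of Burungale–Skinner–Tian–Wan Thm. 12.3
(`L` imaginary quadratic, `p` split), in the rank currency; discharges the `hres` binder shape
`∀ w ∋ p, Finite ↥(Sel ⊓ ker loc_w)`. [cite: BurungaleSkinnerTianWan2024, §12.1.2, proof of Thm. 12.3 (p. 96)]
[cite: Skinner2020, §2.2, Lemma 2 of arXiv:1405.7294 (p. 8), case K_𝔩 ≅ ℚ_p] -/
theorem finite_strictSelmer_adicCompletion_of_mordellWeilRank_eq_one_of_ncard_primesOver_eq_two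
    (h2 : Module.finrank ℚ K = 2) (hsplit : ((Ideal.span {(p : ℤ)}).primesOver (𝓞 K)).ncard = 2)
    (hrank : W.mordellWeilRank = 1) [Finite (AddCommGroup.primaryComponent W.sha p)]
    (w : HeightOneSpectrum (𝓞 K)) (hw : ((p : ℕ) : 𝓞 K) ∈ w.asIdeal) :
    Finite ↥(W.selmerGroupPInfty p ⊓ selmerLocalKerPrimaryTorsion W (w.adicCompletion K) p) := by
  obtain ⟨he, hf⟩ :=
    ramificationIdx_eq_one_and_inertiaDeg_eq_one_of_ncard_primesOver_eq_two p h2 hsplit w hw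
  exact finite_strictSelmer_adicCompletion_of_mordellWeilRank_eq_one W p w hw he hf hrank

/-- **The joint form**: `p` split in a quadratic `K`, rank one, `Ш(E/K)[p^∞]` finite ⟹
`Sel_{p^∞}(E/K) ⊓ ⨅_{w ∣ p} ker loc_w` is finite — hypothesis (inj) of Burungale–Skinner–Tian–Wan
Prop. 12.1 as carried by `BurungaleSkinnerTianWan2024.prop121_pConverse_of_charIdealLe_ordinary_OPEN`,
discharged from `rank_ℤ E(K) = 1 ∧ #Ш(E/K)[p^∞] < ∞`. [cite: BurungaleSkinnerTianWan2024, §12.1.2, proof of Thm. 12.3 (p. 96)]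
[cite: Skinner2020, §2.2, Lemma 2 of arXiv:1405.7294 (p. 8), case K_𝔩 ≅ ℚ_p] -/
theorem finite_strictSelmer_iInf_adicCompletion_of_mordellWeilRank_eq_one_of_ncard_primesOver_eq_two
    (h2 : Module.finrank ℚ K = 2) (hsplit : ((Ideal.span {(p : ℤ)}).primesOver (𝓞 K)).ncard = 2)
    (hrank : W.mordellWeilRank = 1) [Finite (AddCommGroup.primaryComponent W.sha p)] :
    Finite ↥(W.selmerGroupPInfty p ⊓ ⨅ (w : HeightOneSpectrum (𝓞 K))
      (_ : ((p : ℕ) : 𝓞 K) ∈ w.asIdeal), selmerLocalKerPrimaryTorsion W (w.adicCompletion K) p) := by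
  obtain ⟨P, hP⟩ := Set.nonempty_of_ncard_ne_zero
    (s := (Ideal.span {(p : ℤ)}).primesOver (𝓞 K)) (by rw [hsplit]; exact two_ne_zero)
  obtain ⟨hpP, hPbot⟩ := natCast_mem_and_ne_bot_of_mem_primesOver p hP
  obtain ⟨he, hf⟩ :=
    ramificationIdx_eq_one_and_inertiaDeg_eq_one_of_ncard_primesOver_eq_two p h2 hsplit
      ⟨P, hP.1, hPbot⟩ hpP
  exact finite_strictSelmer_iInf_adicCompletion_of_mordellWeilRank_eq_one W p ⟨P, hP.1, hPbot⟩
    hpP he hf hrank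

end Quadratic

end Literature.NumberTheory.EllipticCurves

end
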